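import Literature.Barriers.PneNP.MatchingSlackPsdFoolingSet
import HarnessLib

/-!
# A psd fooling set of size `C(n/2 + 1, 2) − 1` in Edmonds' odd-cut slack matrix

Companion to `MatchingSlackPsdFoolingSet.lean` (the interval family, size `C(n/2 − 1, 2)`) and to
`MatchingSlackPsdRankSmall.lean` (kernel-checked triangular patterns of sizes `5, 9, 14, 20, 27, 35`
for `n = 6, …, 16`). For `n = 2m ≥ 6` this file PROVES, by an explicit two-parameter family, that
the odd-cut slack matrix `S_{UM} = |δ(U) ∩ M| − 1` of the perfect matching polytope of `K_n`
(`pmOddCutSlack n`, rows `OddSet n`, columns `PMatch n`) contains a triangular pattern ("psd fooling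
set", the hypothesis of the tree's `HasPsdFactorization.card_le_of_triangular` =
[FawziEtAl2015, Thm. 2.10 + Ex. 2.11 (p07)]) of size

  `C(m + 1, 2) − 1 = C(m − 1, 2) + 2m − 2`,

so `IsSupportBasedPsdBound (2m) (C(m+1,2) − 1)` and, unconditionally,
`rk_psd(S_odd(K_{2m})) ≥ C(m+1,2) − 1` (`choose_succ_le_of_hasPsdFactorization`). This sharpens
`choose_two_le_of_hasPsdFactorization` (`C(m−1,2)`) by `2m − 2` — same leading term `n²/8` — and
reproduces, for every `m ≥ 3` at once, the values `5, 9, 14, 20, 27, 35` of the small-`n` file, which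
an exhaustive search (cell engineering memo, NOT formalised) found to be the MAXIMUM size of a
triangular pattern for `m ≤ 6`. Everything is proved; there is no named fact. `m = 2` is genuinely
excluded: the odd-cut slack matrix of `K_4` is identically `0`.

## The construction (vertex labels `0, …, n−1`, `M₀ = {01, 23, 45, …}`, `x̄` the `M₀`-partner)
* Columns `T(p,q)` (`TriCol`, partner map `triFun`): `M₀` with the blocks of `0`, `p`, `q` re-matched
  as `{0,p}, {1,q}, {p̄,q̄}` (just `{0,p}, {1,p̄}` when `q = p̄`); an explicit fixed-point-free
  involution, the matching is its edge set `edgesOf` (`HomogeneousMatchingFamilies` §1).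
* The pattern, in order (five shapes; `B(s) = {s−1, s}` the block of an odd label `s`):
  `X0`: `T(n−1,n−2)` with row `{0,1,2}`; then `C(n−1,q)`, `q = n−3, n−5, …, 3`;
  `Y0`: `T(n−2,n−1)` with row `{0,2,n−1}`; then `B(q) = T(n−2,q)` with row `B(q) ∪ {n−2}`,
  `q = n−3, …, 3`; then for odd `p = n−3, n−5, …, 3`: `C(p,q) = T(p,q)` with row
  `{1} ∪ B(q+2) ∪ ⋯ ∪ B(p) = {1} ∪ [q+1, p]`, `q = p−2, …, 3`, followed by `C1(p) = T(p,n−1)` with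
  row `{0} ∪ B(p+2) ∪ ⋯ ∪ B(n−1) = {0} ∪ [p+1, n−1]`. All rows are odd sets of size in `[3, n−3]`
  (genuine Edmonds constraints; rows `mkRow`/`rowY0`). Count: `(m−1) + (m−1) + (m−2) + ⋯ + 1 =
  C(m+1,2) − 1` (`card_idx`). (The family is the cell's, read off a structured exhaustive search and
  script-checked for `n ≤ 30`; relative to that memo the rows of the columns `C(n−1,q)` are taken in
  the uniform `C`-shape `{1} ∪ [q+1, n−1]` instead of `{0} ∪ B(q)` — both work.)
* Crossing numbers (§3): on the diagonal three labels of the row are matched outside the row (we use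
  two, `two_le_cc_of_two`); for an EARLIER column exactly one label of the row is matched outside
  (`cc_eq_one_of_unique`) — sixteen shape combinations `L1–L16`, each an `omega` computation on the
  case table of the partner map (`TriCol.cases`). WHY, in one line (case `p, q` odd): the row is
  `{1} ∪ R` with `R` a union of whole blocks, so against `T(p′,q′)` the untouched blocks contribute
  nothing and `|δ(U) ∩ T(p′,q′)| = [p′ ∈ R] + [q′ ∉ R] + [p′ ∈ R xor q′ ∈ R] ∈ {1, 3}`, `= 3` iff
  `p′ ∈ R ∌ q′`, which among the columns not later than `(p,q)` happens only on the diagonal.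
* Order (§4): indices are label pairs, `C1(p)` recorded as `(p−2, n−1)`; EARLIER = lexicographically
  LARGER, implemented by the two-digit code `(2m − x.1)·2m + (2m − 1 − x.2)` fed to the tree's
  `card_le_of_triangular_code`.

## Main statements
* `isSupportBasedPsdBound_choose_succ (hm : 3 ≤ m) : IsSupportBasedPsdBound (2m) (C(m+1,2) − 1)`;
* `choose_succ_le_of_hasPsdFactorization : HasPsdFactorization (pmOddCutSlack (2m)) r →
  C(m+1,2) − 1 ≤ r` (`m ≥ 3`), and the `Even n`, `n ≥ 6` forms with `C(n/2 + 1, 2) − 1`;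
* `supportBased_window_choose_succ`: the support-based window for `K_{2m}` is
  `[C(m+1,2) − 1, C(2m,2) + 1 − 2m]` (upper end = `supportBasedPsdBound_le_dim`);
* `isSupportBasedPsdBound_eighteen : IsSupportBasedPsdBound 18 44` (first value beyond the
  kernel-checked instances).

Context, honestly. presearch (2026-08-29; corpus `lit search --hybrid` "fooling set lower bound
positive semidefinite rank slack matrix perfect matching polytope", galaxy `psd fooling|semidefinite
fooling|fooling set for psd`, all stars): nothing in print on explicit fooling sets in Edmonds' slack
matrix (as recorded in the companion file); the bound used is [FawziEtAl2015, Thm. 2.10 + Ex. 2.11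
(p07)], page-confirmed. Whether `C(m+1,2) − 1` is the maximum for all `m` (it is for `m ≤ 6` by
search) is NOT claimed; by `supportBasedPsdBound_le_dim` no support-based argument exceeds
`C(n,2) + 1 − n ≈ n²/2`, so the technique class is pinned between `≈ n²/8` and `≈ n²/2`.

Label: instrument — an unconditional POLYNOMIAL floor, the exact optimum of the support-based method
for `n ≤ 12` (by the cell's search) now available for every `n`. WHAT THIS IS NOT: no progress on the
exponential crux (stmt-PneNP-19878 `TracialDecayExp20`) or on the FGPRT open problem beyond `Ω(n²)`;
nothing about nonnegative rank; no P-vs-NP content.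
-/

noncomputable section

open Finset Equiv

namespace Literature.Barriers.PneNP

open Literature.Combinatorics.Optimization (HasPsdFactorization)
open Literature.Combinatorics.SimpleGraph.CycleSpace (Crosses crosses_mk)
open Literature.Combinatorics.AssociationSchemes.HomogeneousMatchingFamilies
  (edgesOf mem_edgesOf mk_mem_edgesOf_iff isPMOn_edgesOf)
open Literature.Combinatorics.AssociationSchemes.MatchingLevelInequality (fpfInvolutions mem_fpfInvolutions)

namespace PsdFoolingSet

variable {n : ℕ}

/-! ### §0 Plumbing: crossing numbers of the edge set of an involution; two-digit codes -/

/-- `π (π x) = x` for a fixed-point-free involution. [folklore] -/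
private theorem fpf_apply_apply' {π : Perm (Fin n)} (hπ : π ∈ fpfInvolutions n) (x : Fin n) :
    π (π x) = x := by
  have h := (mem_fpfInvolutions.1 hπ).1
  rw [← Perm.mul_apply, h, Perm.one_apply]

/-- If `v` is the ONLY vertex of `U` matched outside `U` by the fixed-point-free involution `π`, the
edges of `edgesOf π` crossing `U` are exactly `{v, π v}`. [folklore] -/
private theorem filter_crosses_edgesOf_eq' {π : Perm (Fin n)} (hπ : π ∈ fpfInvolutions n)
    (U : Finset (Fin n)) {v : Fin n} (hv : v ∈ U) (hπv : π v ∉ U)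
    (huniq : ∀ x ∈ U, π x ∉ U → x = v) : (edgesOf π).filter (Crosses U) = {s(v, π v)} := by
  ext e
  simp only [Finset.mem_filter, Finset.mem_singleton]
  constructor
  · rintro ⟨he, hc⟩
    obtain ⟨x, rfl⟩ := mem_edgesOf.1 he
    rw [crosses_mk] at hc
    rcases hc with ⟨hx, hπx⟩ | ⟨hx, hπx⟩
    · rw [huniq x hx hπx]
    · have hxx : π (π x) = x := fpf_apply_apply' hπ x
      have hv' : π x = v := huniq (π x) hπx (by rwa [hxx])
      rw [Sym2.eq_swap, ← hv', hxx]
  · rintro rfl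
    exact ⟨(mk_mem_edgesOf_iff hπ).2 rfl, (crosses_mk _ _ _).2 (Or.inl ⟨hv, hπv⟩)⟩

/-- Two distinct vertices of `U` matched outside `U` give two crossing edges. [folklore] -/
private theorem two_le_card_filter_crosses_edgesOf' {π : Perm (Fin n)} (hπ : π ∈ fpfInvolutions n)
    (U : Finset (Fin n)) {x y : Fin n} (hx : x ∈ U) (hy : y ∈ U) (hxy : x ≠ y) (hπx : π x ∉ U)
    (hπy : π y ∉ U) : 2 ≤ ((edgesOf π).filter (Crosses U)).card := by
  have hsub : ({s(x, π x), s(y, π y)} : Finset (Sym2 (Fin n))) ⊆ (edgesOf π).filter (Crosses U) := by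
    intro e he
    simp only [Finset.mem_insert, Finset.mem_singleton] at he
    rw [Finset.mem_filter]
    rcases he with rfl | rfl
    · exact ⟨(mk_mem_edgesOf_iff hπ).2 rfl, (crosses_mk _ _ _).2 (Or.inl ⟨hx, hπx⟩)⟩
    · exact ⟨(mk_mem_edgesOf_iff hπ).2 rfl, (crosses_mk _ _ _).2 (Or.inl ⟨hy, hπy⟩)⟩
  have hne : s(x, π x) ≠ s(y, π y) := by
    intro h
    rcases Sym2.eq_iff.1 h with ⟨h1, _⟩ | ⟨h1, _⟩
    · exact hxy h1
    · exact hπy (h1 ▸ hx)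
  calc 2 = ({s(x, π x), s(y, π y)} : Finset (Sym2 (Fin n))).card := by rw [Finset.card_pair hne]
    _ ≤ _ := Finset.card_le_card hsub

/-- Two-digit codes `i·N + j` (`j < N`) compare lexicographically. [folklore] -/
private theorem digit_lt {N i j i' j' : ℕ} (hj' : j' < N)
    (h : i * N + j < i' * N + j') : i < i' ∨ (i = i' ∧ j < j') := by
  rcases lt_trichotomy i i' with hlt | rfl | hgt
  · exact Or.inl hlt
  · exact Or.inr ⟨rfl, by omega⟩
  · exfalso
    have h1 : (i' + 1) * N ≤ i * N := Nat.mul_le_mul_right _ (Nat.succ_le_of_lt hgt)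
    rw [Nat.succ_mul] at h1
    omega

/-- Two-digit codes `i·N + j` (`j < N`) are injective. [folklore] -/
private theorem digit_inj {N i j i' j' : ℕ} (hj : j < N) (hj' : j' < N)
    (h : i * N + j = i' * N + j') : i = i' ∧ j = j' := by
  rcases lt_trichotomy i i' with hlt | rfl | hgt
  · exfalso
    have h1 : (i + 1) * N ≤ i' * N := Nat.mul_le_mul_right _ (Nat.succ_le_of_lt hlt)
    rw [Nat.succ_mul] at h1
    omega
  · exact ⟨rfl, by omega⟩
  · exfalso
    have h1 : (i' + 1) * N ≤ i * N := Nat.mul_le_mul_right _ (Nat.succ_le_of_lt hgt)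
    rw [Nat.succ_mul] at h1
    omega

/-! ### §1 The columns: three blocks of `M₀` re-matched -/

/-- **Partner map of the matching `T(p,q)` on vertex labels** `0, 1, 2, …`: the base matching
`M₀ = {01, 23, 45, …}` (partner `x ↦ x ± 1`) with the blocks of `0`, `p` and `q` re-matched as
`{0, p}, {1, q}, {p', q'}`, where `p'`, `q'` are the `M₀`-partners of `p`, `q` (when `q = p'` the touched
set is just `{0, 1, p, p'}` and the last pair is absent — the corresponding branches are then dead).
[folklore] -/
def triFun (p p' q q' x : ℕ) : ℕ :=
  if x = 0 then p
  else if x = p then 0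
  else if x = 1 then q
  else if x = q then 1
  else if x = p' then q'
  else if x = q' then p'
  else if x % 2 = 0 then x + 1
  else x - 1

/-- **The data of a column `T(p,q)`**, a perfect matching of `K_n` (`n` even) in the vocabulary of
the Rothvoß files (`PMatch n`, an element of `𝓜_all`): labels `p, q ∉ {0, 1}`, `p ≠ q`, `< n`, and
their `M₀`-partners `p' = p ± 1`, `q' = q ± 1` (encoded linearly as `p' + 2 (p mod 2) = p + 1`).
The family `T(p,q)` itself is the cell's (engineering memo), not Rothvoß's.
[cite: Rothvoss2017, §2 (PDF p. 6: `𝓜_all`, the perfect matchings of `K_n`)] -/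
structure TriCol (n : ℕ) where
  /-- the label matched to `0` [cite: Rothvoss2017, §2 (PDF p. 6)] -/
  p : ℕ
  /-- the `M₀`-partner of `p` [cite: Rothvoss2017, §2 (PDF p. 6)] -/
  p' : ℕ
  /-- the label matched to `1` [cite: Rothvoss2017, §2 (PDF p. 6)] -/
  q : ℕ
  /-- the `M₀`-partner of `q` [cite: Rothvoss2017, §2 (PDF p. 6)] -/
  q' : ℕ
  /-- validity of the data [cite: Rothvoss2017, §2 (PDF p. 6)] -/
  ok : 2 ≤ p ∧ p < n ∧ 2 ≤ q ∧ q < n ∧ p ≠ q ∧ p' + 2 * (p % 2) = p + 1 ∧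
    q' + 2 * (q % 2) = q + 1 ∧ n % 2 = 0

namespace TriCol

variable (t : TriCol n)

/-- `T(p,q)` lives on `n` labels. [folklore] -/
private theorem triFun_lt {x : ℕ} (hx : x < n) : triFun t.p t.p' t.q t.q' x < n := by
  obtain ⟨h1, h2, h3, h4, h5, h6, h7, h8⟩ := t.ok
  unfold triFun
  split_ifs <;> omega

set_option maxHeartbeats 800000 in -- 8 × 8 case split of the two nested partner maps, each closed by `omega`
/-- `T(p,q)` is an involution. [folklore] -/
private theorem triFun_triFun (x : ℕ) : triFun t.p t.p' t.q t.q' (triFun t.p t.p' t.q t.q' x) = x := by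
  obtain ⟨h1, h2, h3, h4, h5, h6, h7, h8⟩ := t.ok
  generalize hy : triFun t.p t.p' t.q t.q' x = y
  unfold triFun at hy ⊢
  split_ifs at hy <;> split_ifs <;> omega

/-- `T(p,q)` has no fixed point. [folklore] -/
private theorem triFun_ne (x : ℕ) : triFun t.p t.p' t.q t.q' x ≠ x := by
  obtain ⟨h1, h2, h3, h4, h5, h6, h7, h8⟩ := t.ok
  unfold triFun
  split_ifs <;> omega

/-- `T(p,q)` as a map of `Fin n`. [folklore] -/
def fin (x : Fin n) : Fin n := ⟨triFun t.p t.p' t.q t.q' x, t.triFun_lt x.2⟩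

/-- `T(p,q)` is an involution of `Fin n`. [folklore] -/
private theorem fin_involutive : Function.Involutive t.fin := fun x => Fin.ext (t.triFun_triFun x)

/-- `T(p,q)` as a permutation of `Fin n`. [folklore] -/
def perm : Perm (Fin n) := Function.Involutive.toPerm t.fin t.fin_involutive

/-- `T(p,q)` is a fixed-point-free involution. [folklore] -/
private theorem perm_mem : t.perm ∈ fpfInvolutions n := by
  rw [mem_fpfInvolutions]
  refine ⟨Equiv.ext fun x => ?_, fun x hx => ?_⟩
  · rw [Perm.mul_apply, Perm.one_apply]
    exact t.fin_involutive x
  · exact t.triFun_ne x (congrArg Fin.val hx)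

/-- **The perfect matching `T(p,q)` of `K_n`** (a column of the odd-cut slack matrix). [folklore] -/
def toPMatch : PMatch n := ⟨edgesOf t.perm, isPMOn_edgesOf t.perm_mem⟩

/-- **Case table of `T(p,q)`**: which branch of the partner map a label `x` falls into, with the
value of `T(p,q) x` in that branch — the form in which `omega` consumes the partner map. [folklore] -/
private theorem cases (x : ℕ) :
    (x = 0 ∧ triFun t.p t.p' t.q t.q' x = t.p) ∨
    (x ≠ 0 ∧ x = t.p ∧ triFun t.p t.p' t.q t.q' x = 0) ∨
    (x ≠ 0 ∧ x ≠ t.p ∧ x = 1 ∧ triFun t.p t.p' t.q t.q' x = t.q) ∨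
    (x ≠ 0 ∧ x ≠ t.p ∧ x ≠ 1 ∧ x = t.q ∧ triFun t.p t.p' t.q t.q' x = 1) ∨
    (x ≠ 0 ∧ x ≠ t.p ∧ x ≠ 1 ∧ x ≠ t.q ∧ x = t.p' ∧ triFun t.p t.p' t.q t.q' x = t.q') ∨
    (x ≠ 0 ∧ x ≠ t.p ∧ x ≠ 1 ∧ x ≠ t.q ∧ x ≠ t.p' ∧ x = t.q' ∧ triFun t.p t.p' t.q t.q' x = t.p') ∨
    (x ≠ 0 ∧ x ≠ t.p ∧ x ≠ 1 ∧ x ≠ t.q ∧ x ≠ t.p' ∧ x ≠ t.q' ∧ x % 2 = 0 ∧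
      triFun t.p t.p' t.q t.q' x = x + 1) ∨
    (x ≠ 0 ∧ x ≠ t.p ∧ x ≠ 1 ∧ x ≠ t.q ∧ x ≠ t.p' ∧ x ≠ t.q' ∧ x % 2 = 1 ∧
      triFun t.p t.p' t.q t.q' x = x - 1) := by
  unfold triFun
  by_cases h0 : x = 0
  · rw [if_pos h0]; exact Or.inl ⟨h0, rfl⟩
  rw [if_neg h0]
  by_cases h1 : x = t.p
  · rw [if_pos h1]; exact Or.inr <| Or.inl ⟨h0, h1, rfl⟩
  rw [if_neg h1]
  by_cases h2 : x = 1
  · rw [if_pos h2]; exact Or.inr <| Or.inr <| Or.inl ⟨h0, h1, h2, rfl⟩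
  rw [if_neg h2]
  by_cases h3 : x = t.q
  · rw [if_pos h3]; exact Or.inr <| Or.inr <| Or.inr <| Or.inl ⟨h0, h1, h2, h3, rfl⟩
  rw [if_neg h3]
  by_cases h4 : x = t.p'
  · rw [if_pos h4]; exact Or.inr <| Or.inr <| Or.inr <| Or.inr <| Or.inl ⟨h0, h1, h2, h3, h4, rfl⟩
  rw [if_neg h4]
  by_cases h5 : x = t.q'
  · rw [if_pos h5]
    exact Or.inr <| Or.inr <| Or.inr <| Or.inr <| Or.inr <| Or.inl ⟨h0, h1, h2, h3, h4, h5, rfl⟩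
  rw [if_neg h5]
  by_cases h6 : x % 2 = 0
  · rw [if_pos h6]
    exact Or.inr <| Or.inr <| Or.inr <| Or.inr <| Or.inr <| Or.inr <| Or.inl ⟨h0, h1, h2, h3, h4, h5, h6, rfl⟩
  rw [if_neg h6]
  exact Or.inr <| Or.inr <| Or.inr <| Or.inr <| Or.inr <| Or.inr <| Or.inr
    ⟨h0, h1, h2, h3, h4, h5, by omega, rfl⟩

/-- **Tightness test.** If `e` is the only label of `U` (membership predicate `P`) that `T(p,q)`
matches outside `U`, then `|δ(U) ∩ T(p,q)| = 1`, i.e. the matching is tight for the odd-set constraint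
of `U`. [cite: Rothvoss2017, §2 (PDF p. 5)] -/
theorem cc_eq_one_of_unique (U : OddSet n) (P : ℕ → Prop) (hP : ∀ v : Fin n, v ∈ U.1 ↔ P v)
    (e : ℕ) (he : e < n) (h1 : P e) (h2 : ¬P (triFun t.p t.p' t.q t.q' e))
    (h3 : ∀ v, v < n → P v → ¬P (triFun t.p t.p' t.q t.q' v) → v = e) :
    cc U t.toPMatch = 1 := by
  let v : Fin n := ⟨e, he⟩
  have hv : v ∈ U.1 := (hP v).2 h1
  have hπv : t.perm v ∉ U.1 := fun h => h2 ((hP _).1 h)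
  have huniq : ∀ x ∈ U.1, t.perm x ∉ U.1 → x = v := by
    intro x hx hout
    exact Fin.ext (h3 x x.2 ((hP x).1 hx) (fun h => hout ((hP _).2 h)))
  unfold cc
  rw [show t.toPMatch.1 = edgesOf t.perm from rfl,
    filter_crosses_edgesOf_eq' t.perm_mem _ hv hπv huniq, Finset.card_singleton]

/-- **Non-tightness test.** Two distinct labels of `U` matched outside `U` by `T(p,q)` give
`|δ(U) ∩ T(p,q)| ≥ 2`, so the slack `|δ(U) ∩ T(p,q)| − 1` is non-zero. [cite: Rothvoss2017, §2 (PDF p. 5)] -/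
theorem two_le_cc_of_two (U : OddSet n) (P : ℕ → Prop) (hP : ∀ v : Fin n, v ∈ U.1 ↔ P v)
    (x y : ℕ) (hx : x < n) (hy : y < n) (hxy : x ≠ y) (hPx : P x) (hPy : P y)
    (hx' : ¬P (triFun t.p t.p' t.q t.q' x)) (hy' : ¬P (triFun t.p t.p' t.q t.q' y)) :
    2 ≤ cc U t.toPMatch := by
  let a : Fin n := ⟨x, hx⟩
  let b : Fin n := ⟨y, hy⟩
  have hab : a ≠ b := fun h => hxy (congrArg Fin.val h)
  unfold cc
  rw [show t.toPMatch.1 = edgesOf t.perm from rfl]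
  exact two_le_card_filter_crosses_edgesOf' t.perm_mem U.1 ((hP a).2 hPx) ((hP b).2 hPy) hab
    (fun h => hx' ((hP _).1 h)) (fun h => hy' ((hP _).1 h))

end TriCol

/-! ### §2 The rows: a block-aligned interval plus one or two labels -/

/-- `{c} ∪ [lo, hi]` as a set of labels. [folklore] -/
def rowNat (c lo hi : ℕ) : Finset ℕ := insert c (Finset.Icc lo hi)

/-- Membership in `{c} ∪ [lo, hi]`. [folklore] -/
private theorem mem_rowNat {c lo hi v : ℕ} : v ∈ rowNat c lo hi ↔ v = c ∨ (lo ≤ v ∧ v ≤ hi) := by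
  rw [rowNat, Finset.mem_insert, Finset.mem_Icc]

/-- `|{c} ∪ [lo, hi]| = (hi + 1 − lo) + 1` when `c ∉ [lo, hi]`. [folklore] -/
private theorem card_rowNat {c lo hi : ℕ} (h : c < lo ∨ hi < c) :
    (rowNat c lo hi).card = hi + 1 - lo + 1 := by
  rw [rowNat, Finset.card_insert_of_notMem (by rw [Finset.mem_Icc]; omega), Nat.card_Icc]

/-- **The odd set `{c} ∪ [lo, hi]`** of `Fin n` (`c ∉ [lo, hi]`, `hi − lo` odd, so the cardinality
`hi − lo + 2` is odd). [folklore] -/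
def mkRow (n c lo hi : ℕ)
    (h : c < n ∧ hi < n ∧ lo ≤ hi ∧ (c < lo ∨ hi < c) ∧ (hi - lo) % 2 = 1) : OddSet n :=
  ⟨(rowNat c lo hi).attachFin (fun v hv => by rw [mem_rowNat] at hv; omega), by
    rw [Finset.card_attachFin, card_rowNat h.2.2.2.1]
    exact ⟨(hi + 1 - lo) / 2, by omega⟩⟩

/-- Membership in the row `{c} ∪ [lo, hi]`. [folklore] -/
private theorem mem_mkRow {n c lo hi : ℕ}
    (h : c < n ∧ hi < n ∧ lo ≤ hi ∧ (c < lo ∨ hi < c) ∧ (hi - lo) % 2 = 1) (v : Fin n) :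
    v ∈ (mkRow n c lo hi h).1 ↔ (v : ℕ) = c ∨ (lo ≤ (v : ℕ) ∧ (v : ℕ) ≤ hi) := by
  show v ∈ (rowNat c lo hi).attachFin _ ↔ _
  rw [Finset.mem_attachFin, mem_rowNat]

/-- **The odd set `{0, 2, n − 1}`** (`n ≥ 4`). [folklore] -/
def rowY0 (n : ℕ) (hn : 4 ≤ n) : OddSet n :=
  ⟨({0, 2, n - 1} : Finset ℕ).attachFin (fun v hv => by
      simp only [Finset.mem_insert, Finset.mem_singleton] at hv; omega), by
    rw [Finset.card_attachFin, Finset.card_insert_of_notMem (by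
        simp only [Finset.mem_insert, Finset.mem_singleton]; omega),
      Finset.card_pair (by omega)]
    exact ⟨1, rfl⟩⟩

/-- Membership in the row `{0, 2, n − 1}`. [folklore] -/
private theorem mem_rowY0 (hn : 4 ≤ n) (v : Fin n) :
    v ∈ (rowY0 n hn).1 ↔ (v : ℕ) = 0 ∨ (v : ℕ) = 2 ∨ (v : ℕ) = n - 1 := by
  show v ∈ Finset.attachFin _ _ ↔ _
  rw [Finset.mem_attachFin]
  simp only [Finset.mem_insert, Finset.mem_singleton]

/-! ### §3 Crossing numbers: the sixteen tight cases and the five non-tight ones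

Rows and columns of the pattern come in five shapes (`n` even, labels `0, …, n−1`):
* `X0`: column `0↔n−1, 1↔n−2`; row `{0, 1, 2}`;
* `C(p,q)` (`p, q` odd, `3 ≤ q ≤ p − 2`, `p ≤ n − 1`): column `0↔p, 1↔q, p−1↔q−1`; row `{1} ∪ [q+1, p]`;
* `Y0`: column `0↔n−2, 1↔n−1`; row `{0, 2, n−1}`;
* `B(q)` (`q` odd, `3 ≤ q ≤ n−3`): column `0↔n−2, 1↔q, n−1↔q−1`; row `{n−2} ∪ [q−1, q]`;
* `C1(p)` (`p` odd, `3 ≤ p ≤ n−3`; INDEXED below by `a = p − 2`): column `0↔p, 1↔n−1, p−1↔n−2`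
  (the `C`-formula with `q = n−1`); row `{0} ∪ [p+1, n−1]`.
In each tight case we name the unique label of the row matched outside the row (`cc_eq_one_of_unique`);
in the diagonal cases we name two such labels (`two_le_cc_of_two`). All label arithmetic is
discharged by `omega` from the case table `TriCol.cases`. The pattern is the cell's (engineering memo,
verified by script for `n ≤ 30`); the proofs are ours. -/

section Cases

variable (t : TriCol n) (U : OddSet n)

/-- L1: row `C(p,q)` against column `X0` — exit `n−1` if `p = n−1`, else `1`. [folklore] -/
private theorem cc_rowC_colX0 {p q : ℕ}
    (ht : t.p + 1 = n ∧ t.p' + 2 = n ∧ t.q + 2 = n ∧ t.q' + 1 = n)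
    (hU : ∀ v : Fin n, v ∈ U.1 ↔ ((v : ℕ) = 1 ∨ (q + 1 ≤ (v : ℕ) ∧ (v : ℕ) ≤ p)))
    (H : p % 2 = 1 ∧ q % 2 = 1 ∧ 3 ≤ q ∧ q + 2 ≤ p ∧ p < n ∧ 6 ≤ n ∧ n % 2 = 0) :
    cc U t.toPMatch = 1 := by
  by_cases hp : p + 1 = n
  · refine t.cc_eq_one_of_unique U (fun v => v = 1 ∨ (q + 1 ≤ v ∧ v ≤ p)) hU (n - 1)
      (by omega) (by omega) ?_ ?_
    · have := t.cases (n - 1); omega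
    · intro v hv hPv hTv; have := t.cases v; omega
  · refine t.cc_eq_one_of_unique U (fun v => v = 1 ∨ (q + 1 ≤ v ∧ v ≤ p)) hU 1
      (by omega) (by omega) ?_ ?_
    · have := t.cases 1; omega
    · intro v hv hPv hTv; have := t.cases v; omega

/-- L2: row `C(p,q)` against column `C(P,Q)` with `P ≥ p + 2` (this includes the columns `C1`) —
exit `Q − 1` if `Q ∈ [q+1, p]`, else `1`. [folklore] -/
private theorem cc_rowC_colC_gt {p q P Q : ℕ}
    (ht : t.p = P ∧ t.p' + 1 = P ∧ t.q = Q ∧ t.q' + 1 = Q)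
    (hU : ∀ v : Fin n, v ∈ U.1 ↔ ((v : ℕ) = 1 ∨ (q + 1 ≤ (v : ℕ) ∧ (v : ℕ) ≤ p)))
    (H : p % 2 = 1 ∧ q % 2 = 1 ∧ P % 2 = 1 ∧ Q % 2 = 1 ∧ 3 ≤ q ∧ q + 2 ≤ p ∧ p + 2 ≤ P ∧ P < n ∧
      3 ≤ Q ∧ Q ≠ P ∧ Q < n ∧ n % 2 = 0) : cc U t.toPMatch = 1 := by
  by_cases hQ : q + 1 ≤ Q ∧ Q ≤ p
  · refine t.cc_eq_one_of_unique U (fun v => v = 1 ∨ (q + 1 ≤ v ∧ v ≤ p)) hU (Q - 1)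
      (by omega) (by omega) ?_ ?_
    · have := t.cases (Q - 1); omega
    · intro v hv hPv hTv; have := t.cases v; omega
  · refine t.cc_eq_one_of_unique U (fun v => v = 1 ∨ (q + 1 ≤ v ∧ v ≤ p)) hU 1
      (by omega) (by omega) ?_ ?_
    · have := t.cases 1; omega
    · intro v hv hPv hTv; have := t.cases v; omega

/-- L3: row `C(p,q)` against column `C(p,Q)` with `q < Q ≤ p − 2` — exit `p`. [folklore] -/
private theorem cc_rowC_colC_eq {p q Q : ℕ}
    (ht : t.p = p ∧ t.p' + 1 = p ∧ t.q = Q ∧ t.q' + 1 = Q)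
    (hU : ∀ v : Fin n, v ∈ U.1 ↔ ((v : ℕ) = 1 ∨ (q + 1 ≤ (v : ℕ) ∧ (v : ℕ) ≤ p)))
    (H : p % 2 = 1 ∧ q % 2 = 1 ∧ Q % 2 = 1 ∧ 3 ≤ q ∧ q + 2 ≤ Q ∧ Q + 2 ≤ p ∧ p < n ∧ n % 2 = 0) :
    cc U t.toPMatch = 1 := by
  refine t.cc_eq_one_of_unique U (fun v => v = 1 ∨ (q + 1 ≤ v ∧ v ≤ p)) hU p
    (by omega) (by omega) ?_ ?_
  · have := t.cases p; omega
  · intro v hv hPv hTv; have := t.cases v; omega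

/-- L4: row `C(p,q)` (`p ≤ n−3`) against column `Y0` — exit `1`. [folklore] -/
private theorem cc_rowC_colY0 {p q : ℕ}
    (ht : t.p + 2 = n ∧ t.p' + 1 = n ∧ t.q + 1 = n ∧ t.q' + 2 = n)
    (hU : ∀ v : Fin n, v ∈ U.1 ↔ ((v : ℕ) = 1 ∨ (q + 1 ≤ (v : ℕ) ∧ (v : ℕ) ≤ p)))
    (H : p % 2 = 1 ∧ q % 2 = 1 ∧ 3 ≤ q ∧ q + 2 ≤ p ∧ p + 3 ≤ n ∧ n % 2 = 0) :
    cc U t.toPMatch = 1 := by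
  refine t.cc_eq_one_of_unique U (fun v => v = 1 ∨ (q + 1 ≤ v ∧ v ≤ p)) hU 1
    (by omega) (by omega) ?_ ?_
  · have := t.cases 1; omega
  · intro v hv hPv hTv; have := t.cases v; omega

/-- L5: row `C(p,q)` (`p ≤ n−3`) against column `B(Q)` — exit `Q − 1` if `Q ∈ [q+1, p]`, else `1`.
[folklore] -/
private theorem cc_rowC_colB {p q Q : ℕ}
    (ht : t.p + 2 = n ∧ t.p' + 1 = n ∧ t.q = Q ∧ t.q' + 1 = Q)
    (hU : ∀ v : Fin n, v ∈ U.1 ↔ ((v : ℕ) = 1 ∨ (q + 1 ≤ (v : ℕ) ∧ (v : ℕ) ≤ p)))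
    (H : p % 2 = 1 ∧ q % 2 = 1 ∧ Q % 2 = 1 ∧ 3 ≤ q ∧ q + 2 ≤ p ∧ p + 3 ≤ n ∧ 3 ≤ Q ∧ Q + 3 ≤ n ∧
      n % 2 = 0) : cc U t.toPMatch = 1 := by
  by_cases hQ : q + 1 ≤ Q ∧ Q ≤ p
  · refine t.cc_eq_one_of_unique U (fun v => v = 1 ∨ (q + 1 ≤ v ∧ v ≤ p)) hU (Q - 1)
      (by omega) (by omega) ?_ ?_
    · have := t.cases (Q - 1); omega
    · intro v hv hPv hTv; have := t.cases v; omega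
  · refine t.cc_eq_one_of_unique U (fun v => v = 1 ∨ (q + 1 ≤ v ∧ v ≤ p)) hU 1
      (by omega) (by omega) ?_ ?_
    · have := t.cases 1; omega
    · intro v hv hPv hTv; have := t.cases v; omega

/-- L6: row `Y0` against column `X0` — exit `2`. [folklore] -/
private theorem cc_rowY0_colX0
    (ht : t.p + 1 = n ∧ t.p' + 2 = n ∧ t.q + 2 = n ∧ t.q' + 1 = n)
    (hU : ∀ v : Fin n, v ∈ U.1 ↔ ((v : ℕ) = 0 ∨ (v : ℕ) = 2 ∨ (v : ℕ) = n - 1))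
    (H : 6 ≤ n ∧ n % 2 = 0) : cc U t.toPMatch = 1 := by
  refine t.cc_eq_one_of_unique U (fun v => v = 0 ∨ v = 2 ∨ v = n - 1) hU 2
    (by omega) (by omega) ?_ ?_
  · have := t.cases 2; omega
  · intro v hv hPv hTv; have := t.cases v; omega

/-- L7: row `Y0` against column `C(n−1,Q)` — exit `2`. [folklore] -/
private theorem cc_rowY0_colC {Q : ℕ}
    (ht : t.p + 1 = n ∧ t.p' + 2 = n ∧ t.q = Q ∧ t.q' + 1 = Q)
    (hU : ∀ v : Fin n, v ∈ U.1 ↔ ((v : ℕ) = 0 ∨ (v : ℕ) = 2 ∨ (v : ℕ) = n - 1))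
    (H : Q % 2 = 1 ∧ 3 ≤ Q ∧ Q + 3 ≤ n ∧ n % 2 = 0) : cc U t.toPMatch = 1 := by
  refine t.cc_eq_one_of_unique U (fun v => v = 0 ∨ v = 2 ∨ v = n - 1) hU 2
    (by omega) (by omega) ?_ ?_
  · have := t.cases 2; omega
  · intro v hv hPv hTv; have := t.cases v; omega

/-- L8: row `B(q)` against column `X0` — exit `n−2`. [folklore] -/
private theorem cc_rowB_colX0 {q : ℕ}
    (ht : t.p + 1 = n ∧ t.p' + 2 = n ∧ t.q + 2 = n ∧ t.q' + 1 = n)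
    (hU : ∀ v : Fin n, v ∈ U.1 ↔ ((v : ℕ) = n - 2 ∨ (q - 1 ≤ (v : ℕ) ∧ (v : ℕ) ≤ q)))
    (H : q % 2 = 1 ∧ 3 ≤ q ∧ q + 3 ≤ n ∧ n % 2 = 0) : cc U t.toPMatch = 1 := by
  refine t.cc_eq_one_of_unique U (fun v => v = n - 2 ∨ (q - 1 ≤ v ∧ v ≤ q)) hU (n - 2)
    (by omega) (by omega) ?_ ?_
  · have := t.cases (n - 2); omega
  · intro v hv hPv hTv; have := t.cases v; omega

/-- L9: row `B(q)` against column `C(n−1,Q)` — exit `q` if `Q = q`, else `n−2`. [folklore] -/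
private theorem cc_rowB_colC {q Q : ℕ}
    (ht : t.p + 1 = n ∧ t.p' + 2 = n ∧ t.q = Q ∧ t.q' + 1 = Q)
    (hU : ∀ v : Fin n, v ∈ U.1 ↔ ((v : ℕ) = n - 2 ∨ (q - 1 ≤ (v : ℕ) ∧ (v : ℕ) ≤ q)))
    (H : q % 2 = 1 ∧ Q % 2 = 1 ∧ 3 ≤ q ∧ q + 3 ≤ n ∧ 3 ≤ Q ∧ Q + 3 ≤ n ∧ n % 2 = 0) :
    cc U t.toPMatch = 1 := by
  by_cases hQ : Q = q
  · refine t.cc_eq_one_of_unique U (fun v => v = n - 2 ∨ (q - 1 ≤ v ∧ v ≤ q)) hU q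
      (by omega) (by omega) ?_ ?_
    · have := t.cases q; omega
    · intro v hv hPv hTv; have := t.cases v; omega
  · refine t.cc_eq_one_of_unique U (fun v => v = n - 2 ∨ (q - 1 ≤ v ∧ v ≤ q)) hU (n - 2)
      (by omega) (by omega) ?_ ?_
    · have := t.cases (n - 2); omega
    · intro v hv hPv hTv; have := t.cases v; omega

/-- L10: row `B(q)` against column `Y0` — exit `n−2`. [folklore] -/
private theorem cc_rowB_colY0 {q : ℕ}
    (ht : t.p + 2 = n ∧ t.p' + 1 = n ∧ t.q + 1 = n ∧ t.q' + 2 = n)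
    (hU : ∀ v : Fin n, v ∈ U.1 ↔ ((v : ℕ) = n - 2 ∨ (q - 1 ≤ (v : ℕ) ∧ (v : ℕ) ≤ q)))
    (H : q % 2 = 1 ∧ 3 ≤ q ∧ q + 3 ≤ n ∧ n % 2 = 0) : cc U t.toPMatch = 1 := by
  refine t.cc_eq_one_of_unique U (fun v => v = n - 2 ∨ (q - 1 ≤ v ∧ v ≤ q)) hU (n - 2)
    (by omega) (by omega) ?_ ?_
  · have := t.cases (n - 2); omega
  · intro v hv hPv hTv; have := t.cases v; omega

/-- L11: row `B(q)` against column `B(Q)` with `Q > q` — exit `n−2`. [folklore] -/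
private theorem cc_rowB_colB {q Q : ℕ}
    (ht : t.p + 2 = n ∧ t.p' + 1 = n ∧ t.q = Q ∧ t.q' + 1 = Q)
    (hU : ∀ v : Fin n, v ∈ U.1 ↔ ((v : ℕ) = n - 2 ∨ (q - 1 ≤ (v : ℕ) ∧ (v : ℕ) ≤ q)))
    (H : q % 2 = 1 ∧ Q % 2 = 1 ∧ 3 ≤ q ∧ q + 2 ≤ Q ∧ Q + 3 ≤ n ∧ n % 2 = 0) :
    cc U t.toPMatch = 1 := by
  refine t.cc_eq_one_of_unique U (fun v => v = n - 2 ∨ (q - 1 ≤ v ∧ v ≤ q)) hU (n - 2)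
    (by omega) (by omega) ?_ ?_
  · have := t.cases (n - 2); omega
  · intro v hv hPv hTv; have := t.cases v; omega

/-- L12: row `C1(a+2) = {0} ∪ [a+3, n−1]` against column `X0` — exit `n−2`. [folklore] -/
private theorem cc_rowC1_colX0 {a : ℕ}
    (ht : t.p + 1 = n ∧ t.p' + 2 = n ∧ t.q + 2 = n ∧ t.q' + 1 = n)
    (hU : ∀ v : Fin n, v ∈ U.1 ↔ ((v : ℕ) = 0 ∨ (a + 3 ≤ (v : ℕ) ∧ (v : ℕ) ≤ n - 1)))
    (H : a % 2 = 1 ∧ a + 5 ≤ n ∧ n % 2 = 0) : cc U t.toPMatch = 1 := by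
  refine t.cc_eq_one_of_unique U (fun v => v = 0 ∨ (a + 3 ≤ v ∧ v ≤ n - 1)) hU (n - 2)
    (by omega) (by omega) ?_ ?_
  · have := t.cases (n - 2); omega
  · intro v hv hPv hTv; have := t.cases v; omega

/-- L13: row `C1(a+2)` against column `C(P,Q)` with `P ≥ a + 4` (includes the columns `C1`) —
exit `Q` if `Q ≥ a + 4`, else `P − 1`. [folklore] -/
private theorem cc_rowC1_colC_gt {a P Q : ℕ}
    (ht : t.p = P ∧ t.p' + 1 = P ∧ t.q = Q ∧ t.q' + 1 = Q)
    (hU : ∀ v : Fin n, v ∈ U.1 ↔ ((v : ℕ) = 0 ∨ (a + 3 ≤ (v : ℕ) ∧ (v : ℕ) ≤ n - 1)))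
    (H : a % 2 = 1 ∧ P % 2 = 1 ∧ Q % 2 = 1 ∧ a + 5 ≤ n ∧ a + 4 ≤ P ∧ P < n ∧ 3 ≤ Q ∧ Q ≠ P ∧
      Q < n ∧ n % 2 = 0) : cc U t.toPMatch = 1 := by
  by_cases hQ : a + 4 ≤ Q
  · refine t.cc_eq_one_of_unique U (fun v => v = 0 ∨ (a + 3 ≤ v ∧ v ≤ n - 1)) hU Q
      (by omega) (by omega) ?_ ?_
    · have := t.cases Q; omega
    · intro v hv hPv hTv; have := t.cases v; omega
  · refine t.cc_eq_one_of_unique U (fun v => v = 0 ∨ (a + 3 ≤ v ∧ v ≤ n - 1)) hU (P - 1)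
      (by omega) (by omega) ?_ ?_
    · have := t.cases (P - 1); omega
    · intro v hv hPv hTv; have := t.cases v; omega

/-- L14: row `C1(a+2)` against column `C(a+2,Q)` (`Q ≤ a`) — exit `0`. [folklore] -/
private theorem cc_rowC1_colC_eq {a Q : ℕ}
    (ht : t.p = a + 2 ∧ t.p' + 1 = a + 2 ∧ t.q = Q ∧ t.q' + 1 = Q)
    (hU : ∀ v : Fin n, v ∈ U.1 ↔ ((v : ℕ) = 0 ∨ (a + 3 ≤ (v : ℕ) ∧ (v : ℕ) ≤ n - 1)))
    (H : a % 2 = 1 ∧ Q % 2 = 1 ∧ a + 5 ≤ n ∧ 3 ≤ Q ∧ Q ≤ a ∧ n % 2 = 0) :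
    cc U t.toPMatch = 1 := by
  refine t.cc_eq_one_of_unique U (fun v => v = 0 ∨ (a + 3 ≤ v ∧ v ≤ n - 1)) hU 0
    (by omega) (by omega) ?_ ?_
  · have := t.cases 0; omega
  · intro v hv hPv hTv; have := t.cases v; omega

/-- L15: row `C1(a+2)` against column `Y0` — exit `n−1`. [folklore] -/
private theorem cc_rowC1_colY0 {a : ℕ}
    (ht : t.p + 2 = n ∧ t.p' + 1 = n ∧ t.q + 1 = n ∧ t.q' + 2 = n)
    (hU : ∀ v : Fin n, v ∈ U.1 ↔ ((v : ℕ) = 0 ∨ (a + 3 ≤ (v : ℕ) ∧ (v : ℕ) ≤ n - 1)))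
    (H : a % 2 = 1 ∧ a + 5 ≤ n ∧ n % 2 = 0) : cc U t.toPMatch = 1 := by
  refine t.cc_eq_one_of_unique U (fun v => v = 0 ∨ (a + 3 ≤ v ∧ v ≤ n - 1)) hU (n - 1)
    (by omega) (by omega) ?_ ?_
  · have := t.cases (n - 1); omega
  · intro v hv hPv hTv; have := t.cases v; omega

/-- L16: row `C1(a+2)` against column `B(Q)` — exit `Q` if `Q ≥ a + 4`, else `n−1`. [folklore] -/
private theorem cc_rowC1_colB {a Q : ℕ}
    (ht : t.p + 2 = n ∧ t.p' + 1 = n ∧ t.q = Q ∧ t.q' + 1 = Q)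
    (hU : ∀ v : Fin n, v ∈ U.1 ↔ ((v : ℕ) = 0 ∨ (a + 3 ≤ (v : ℕ) ∧ (v : ℕ) ≤ n - 1)))
    (H : a % 2 = 1 ∧ Q % 2 = 1 ∧ a + 5 ≤ n ∧ 3 ≤ Q ∧ Q + 3 ≤ n ∧ n % 2 = 0) :
    cc U t.toPMatch = 1 := by
  by_cases hQ : a + 4 ≤ Q
  · refine t.cc_eq_one_of_unique U (fun v => v = 0 ∨ (a + 3 ≤ v ∧ v ≤ n - 1)) hU Q
      (by omega) (by omega) ?_ ?_
    · have := t.cases Q; omega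
    · intro v hv hPv hTv; have := t.cases v; omega
  · refine t.cc_eq_one_of_unique U (fun v => v = 0 ∨ (a + 3 ≤ v ∧ v ≤ n - 1)) hU (n - 1)
      (by omega) (by omega) ?_ ?_
    · have := t.cases (n - 1); omega
    · intro v hv hPv hTv; have := t.cases v; omega

/-- D1: row `X0 = {2} ∪ [0, 1]` against column `X0` — labels `0` and `1` are matched outside.
[folklore] -/
private theorem two_le_cc_X0
    (ht : t.p + 1 = n ∧ t.p' + 2 = n ∧ t.q + 2 = n ∧ t.q' + 1 = n)
    (hU : ∀ v : Fin n, v ∈ U.1 ↔ ((v : ℕ) = 2 ∨ (0 ≤ (v : ℕ) ∧ (v : ℕ) ≤ 1)))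
    (H : 6 ≤ n) : 2 ≤ cc U t.toPMatch := by
  refine t.two_le_cc_of_two U (fun v => v = 2 ∨ (0 ≤ v ∧ v ≤ 1)) hU 0 1
    (by omega) (by omega) (by omega) (by omega) (by omega) ?_ ?_
  · have := t.cases 0; omega
  · have := t.cases 1; omega

/-- D2: row `C(p,q)` against column `C(p,q)` — labels `1` and `p` are matched outside. [folklore] -/
private theorem two_le_cc_C {p q : ℕ}
    (ht : t.p = p ∧ t.p' + 1 = p ∧ t.q = q ∧ t.q' + 1 = q)
    (hU : ∀ v : Fin n, v ∈ U.1 ↔ ((v : ℕ) = 1 ∨ (q + 1 ≤ (v : ℕ) ∧ (v : ℕ) ≤ p)))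
    (H : p % 2 = 1 ∧ q % 2 = 1 ∧ 3 ≤ q ∧ q + 2 ≤ p ∧ p < n) : 2 ≤ cc U t.toPMatch := by
  refine t.two_le_cc_of_two U (fun v => v = 1 ∨ (q + 1 ≤ v ∧ v ≤ p)) hU 1 p
    (by omega) (by omega) (by omega) (by omega) (by omega) ?_ ?_
  · have := t.cases 1; omega
  · have := t.cases p; omega

/-- D3: row `Y0` against column `Y0` — labels `0` and `n−1` are matched outside. [folklore] -/
private theorem two_le_cc_Y0
    (ht : t.p + 2 = n ∧ t.p' + 1 = n ∧ t.q + 1 = n ∧ t.q' + 2 = n)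
    (hU : ∀ v : Fin n, v ∈ U.1 ↔ ((v : ℕ) = 0 ∨ (v : ℕ) = 2 ∨ (v : ℕ) = n - 1))
    (H : 6 ≤ n) : 2 ≤ cc U t.toPMatch := by
  refine t.two_le_cc_of_two U (fun v => v = 0 ∨ v = 2 ∨ v = n - 1) hU 0 (n - 1)
    (by omega) (by omega) (by omega) (by omega) (by omega) ?_ ?_
  · have := t.cases 0; omega
  · have := t.cases (n - 1); omega

/-- D4: row `B(q)` against column `B(q)` — labels `q` and `n−2` are matched outside. [folklore] -/
private theorem two_le_cc_B {q : ℕ}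
    (ht : t.p + 2 = n ∧ t.p' + 1 = n ∧ t.q = q ∧ t.q' + 1 = q)
    (hU : ∀ v : Fin n, v ∈ U.1 ↔ ((v : ℕ) = n - 2 ∨ (q - 1 ≤ (v : ℕ) ∧ (v : ℕ) ≤ q)))
    (H : q % 2 = 1 ∧ 3 ≤ q ∧ q + 3 ≤ n) : 2 ≤ cc U t.toPMatch := by
  refine t.two_le_cc_of_two U (fun v => v = n - 2 ∨ (q - 1 ≤ v ∧ v ≤ q)) hU q (n - 2)
    (by omega) (by omega) (by omega) (by omega) (by omega) ?_ ?_
  · have := t.cases q; omega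
  · have := t.cases (n - 2); omega

/-- D5: row `C1(a+2)` against column `C(a+2, n−1)` — labels `0` and `n−1` are matched outside.
[folklore] -/
private theorem two_le_cc_C1 {a : ℕ}
    (ht : t.p = a + 2 ∧ t.p' + 1 = a + 2 ∧ t.q = n - 1 ∧ t.q' + 1 = n - 1)
    (hU : ∀ v : Fin n, v ∈ U.1 ↔ ((v : ℕ) = 0 ∨ (a + 3 ≤ (v : ℕ) ∧ (v : ℕ) ≤ n - 1)))
    (H : a % 2 = 1 ∧ a + 5 ≤ n) : 2 ≤ cc U t.toPMatch := by
  refine t.two_le_cc_of_two U (fun v => v = 0 ∨ (a + 3 ≤ v ∧ v ≤ n - 1)) hU 0 (n - 1)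
    (by omega) (by omega) (by omega) (by omega) (by omega) ?_ ?_
  · have := t.cases 0; omega
  · have := t.cases (n - 1); omega

end Cases

/-! ### §4 The index set: five families of label pairs, `C(m+1, 2) − 1` in all -/

variable {m : ℕ}

/-- Swapping–scaling map `(b, a) ↦ (2b+3, 2a+3)` on sigma pairs is injective. [folklore] -/
private theorem oddPair_injective :
    Function.Injective (fun x : (Σ _ : ℕ, ℕ) => (2 * x.1 + 3, 2 * x.2 + 3)) := by
  rintro ⟨b, a⟩ ⟨b', a'⟩ h
  simp only [Prod.mk.injEq] at h
  obtain ⟨h1, h2⟩ := h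
  have hb : b = b' := by omega
  have ha : a = a' := by omega
  subst hb; subst ha; rfl

/-- Index of `X0`: the pair `(n−1, n−2)`. [folklore] -/
private def idxX0 (m : ℕ) : Finset (ℕ × ℕ) := {(2 * m - 1, 2 * m - 2)}

/-- Indices of the columns `C(p,q)`: pairs of odd labels `3 ≤ q < p ≤ n − 1`. [folklore] -/
private def idxC (m : ℕ) : Finset (ℕ × ℕ) :=
  ((Finset.range (m - 1)).sigma fun b => Finset.range b).map ⟨_, oddPair_injective⟩

/-- Index of `Y0`: the pair `(n−2, n−1)`. [folklore] -/
private def idxY0 (m : ℕ) : Finset (ℕ × ℕ) := {(2 * m - 2, 2 * m - 1)}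

/-- Indices of the columns `B(q)`: pairs `(n−2, q)`, `q` odd, `3 ≤ q ≤ n−3`. [folklore] -/
private def idxB (m : ℕ) : Finset (ℕ × ℕ) :=
  (Finset.range (m - 2)).image fun k => (2 * m - 2, 2 * k + 3)

/-- Indices of the columns `C1(p) = C(p, n−1)`, `p` odd, `3 ≤ p ≤ n−3`, RECORDED AS `(p − 2, n − 1)`
(so that the lexicographic order of indices is the order of the pattern). [folklore] -/
private def idxC1 (m : ℕ) : Finset (ℕ × ℕ) :=
  (Finset.range (m - 2)).image fun k => (2 * k + 1, 2 * m - 1)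

/-- The index set of the pattern. [folklore] -/
private def idx (m : ℕ) : Finset (ℕ × ℕ) := idxX0 m ∪ idxC m ∪ idxY0 m ∪ idxB m ∪ idxC1 m

/-- Shape of an `X0` index. [folklore] -/
private theorem memX0 {x : ℕ × ℕ} (hx : x ∈ idxX0 m) : x.1 = 2 * m - 1 ∧ x.2 = 2 * m - 2 := by
  rw [idxX0, Finset.mem_singleton] at hx
  subst hx; exact ⟨rfl, rfl⟩

/-- Shape of a `C` index. [folklore] -/
private theorem memC {x : ℕ × ℕ} (hx : x ∈ idxC m) :
    x.1 % 2 = 1 ∧ x.2 % 2 = 1 ∧ 3 ≤ x.2 ∧ x.2 + 2 ≤ x.1 ∧ x.1 < 2 * m := by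
  rw [idxC, Finset.mem_map] at hx
  obtain ⟨y, hy, rfl⟩ := hx
  rw [Finset.mem_sigma, Finset.mem_range, Finset.mem_range] at hy
  show (2 * y.1 + 3) % 2 = 1 ∧ (2 * y.2 + 3) % 2 = 1 ∧ 3 ≤ 2 * y.2 + 3 ∧
    2 * y.2 + 3 + 2 ≤ 2 * y.1 + 3 ∧ 2 * y.1 + 3 < 2 * m
  omega

/-- Shape of a `Y0` index. [folklore] -/
private theorem memY0 {x : ℕ × ℕ} (hx : x ∈ idxY0 m) : x.1 = 2 * m - 2 ∧ x.2 = 2 * m - 1 := by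
  rw [idxY0, Finset.mem_singleton] at hx
  subst hx; exact ⟨rfl, rfl⟩

/-- Shape of a `B` index. [folklore] -/
private theorem memB {x : ℕ × ℕ} (hx : x ∈ idxB m) :
    x.1 = 2 * m - 2 ∧ x.2 % 2 = 1 ∧ 3 ≤ x.2 ∧ x.2 + 3 ≤ 2 * m := by
  rw [idxB, Finset.mem_image] at hx
  obtain ⟨k, hk, rfl⟩ := hx
  rw [Finset.mem_range] at hk
  refine ⟨rfl, ?_, ?_, ?_⟩ <;> dsimp only <;> omega

/-- Shape of a `C1` index. [folklore] -/
private theorem memC1 {x : ℕ × ℕ} (hx : x ∈ idxC1 m) :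
    x.1 % 2 = 1 ∧ 1 ≤ x.1 ∧ x.1 + 5 ≤ 2 * m ∧ x.2 = 2 * m - 1 := by
  rw [idxC1, Finset.mem_image] at hx
  obtain ⟨k, hk, rfl⟩ := hx
  rw [Finset.mem_range] at hk
  refine ⟨?_, ?_, ?_, rfl⟩ <;> dsimp only <;> omega

/-- The five shapes of an index of the pattern. [folklore] -/
private theorem shape_of_mem {x : ℕ × ℕ} (hx : x ∈ idx m) :
    (x.1 = 2 * m - 1 ∧ x.2 = 2 * m - 2) ∨
    (x.1 % 2 = 1 ∧ x.2 % 2 = 1 ∧ 3 ≤ x.2 ∧ x.2 + 2 ≤ x.1 ∧ x.1 < 2 * m) ∨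
    (x.1 = 2 * m - 2 ∧ x.2 = 2 * m - 1) ∨
    (x.1 = 2 * m - 2 ∧ x.2 % 2 = 1 ∧ 3 ≤ x.2 ∧ x.2 + 3 ≤ 2 * m) ∨
    (x.1 % 2 = 1 ∧ 1 ≤ x.1 ∧ x.1 + 5 ≤ 2 * m ∧ x.2 = 2 * m - 1) := by
  simp only [idx, Finset.mem_union] at hx
  rcases hx with (((h | h) | h) | h) | h
  · exact Or.inl (memX0 h)
  · exact Or.inr (Or.inl (memC h))
  · exact Or.inr (Or.inr (Or.inl (memY0 h)))
  · exact Or.inr (Or.inr (Or.inr (Or.inl (memB h))))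
  · exact Or.inr (Or.inr (Or.inr (Or.inr (memC1 h))))

/-- `|idxC m| = C(m−1, 2)`. [folklore] -/
private theorem card_idxC (m : ℕ) : (idxC m).card = (m - 1).choose 2 := by
  rw [idxC, Finset.card_map, Finset.card_sigma]
  simp only [Finset.card_range]
  have h := Finset.sum_range_id_mul_two (m - 1)
  rw [Nat.choose_two_right]
  omega

/-- `|idxB m| = m − 2`. [folklore] -/
private theorem card_idxB (m : ℕ) : (idxB m).card = m - 2 := by
  rw [idxB, Finset.card_image_of_injective _ (fun a b h => by
    simp only [Prod.mk.injEq] at h; omega), Finset.card_range]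

/-- `|idxC1 m| = m − 2`. [folklore] -/
private theorem card_idxC1 (m : ℕ) : (idxC1 m).card = m - 2 := by
  rw [idxC1, Finset.card_image_of_injective _ (fun a b h => by
    simp only [Prod.mk.injEq] at h; omega), Finset.card_range]

/-- **The pattern has `C(m+1, 2) − 1` entries** (`m ≥ 3`):
`1 + C(m−1,2) + 1 + (m−2) + (m−2) = C(m+1,2) − 1`. [folklore] -/
private theorem card_idx (hm : 3 ≤ m) : (idx m).card = (m + 1).choose 2 - 1 := by
  have d1 : Disjoint (idxX0 m) (idxC m) := Finset.disjoint_left.2 fun x h h' => by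
    have := memX0 h; have := memC h'; omega
  have d2 : Disjoint (idxX0 m ∪ idxC m) (idxY0 m) := Finset.disjoint_left.2 fun x h h' => by
    have := memY0 h'
    rcases Finset.mem_union.1 h with h | h
    · have := memX0 h; omega
    · have := memC h; omega
  have d3 : Disjoint (idxX0 m ∪ idxC m ∪ idxY0 m) (idxB m) := Finset.disjoint_left.2 fun x h h' => by
    have := memB h'
    rcases Finset.mem_union.1 h with h | h
    · rcases Finset.mem_union.1 h with h | h
      · have := memX0 h; omega
      · have := memC h; omega
    · have := memY0 h; omega
  have d4 : Disjoint (idxX0 m ∪ idxC m ∪ idxY0 m ∪ idxB m) (idxC1 m) :=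
    Finset.disjoint_left.2 fun x h h' => by
      have := memC1 h'
      rcases Finset.mem_union.1 h with h | h
      · rcases Finset.mem_union.1 h with h | h
        · rcases Finset.mem_union.1 h with h | h
          · have := memX0 h; omega
          · have := memC h; omega
        · have := memY0 h; omega
      · have := memB h; omega
  rw [idx, Finset.card_union_of_disjoint d4, Finset.card_union_of_disjoint d3,
    Finset.card_union_of_disjoint d2, Finset.card_union_of_disjoint d1, idxX0, idxY0,
    Finset.card_singleton, Finset.card_singleton, card_idxC, card_idxB, card_idxC1]
  have h1 : (m + 1).choose 2 = m + m.choose 2 := by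
    rw [Nat.choose_succ_succ, Nat.choose_one_right]
  have h2 : m.choose 2 = (m - 1) + (m - 1).choose 2 := by
    obtain ⟨k, rfl⟩ : ∃ k, m = k + 1 := ⟨m - 1, by omega⟩
    rw [Nat.choose_succ_succ, Nat.choose_one_right, Nat.add_sub_cancel]
  omega

/-- The code of an index: decreasing lexicographic order of `(x.1, x.2)` written with two digits in
base `2m`. [folklore] -/
private def code (m : ℕ) (x : ℕ × ℕ) : ℕ := (2 * m - x.1) * (2 * m) + (2 * m - 1 - x.2)

/-- Both coordinates of an index are labels `< 2m`. [folklore] -/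
private theorem lt_of_mem (hm : 3 ≤ m) {x : ℕ × ℕ} (hx : x ∈ idx m) :
    x.1 < 2 * m ∧ x.2 < 2 * m := by
  rcases shape_of_mem hx with h | h | h | h | h <;> omega

/-- The code is injective on the index set. [folklore] -/
private theorem code_injOn (hm : 3 ≤ m) : Set.InjOn (code m) ↑(idx m) := by
  intro x hx y hy hxy
  have hx' := lt_of_mem hm (Finset.mem_coe.1 hx)
  have hy' := lt_of_mem hm (Finset.mem_coe.1 hy)
  obtain ⟨h1, h2⟩ := digit_inj (N := 2 * m) (by omega) (by omega) hxy
  exact Prod.ext (by omega) (by omega)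

/-- A smaller code means a lexicographically LARGER index. [folklore] -/
private theorem lex_of_code_lt (hm : 3 ≤ m) {x y : ℕ × ℕ} (hx : x ∈ idx m) (hy : y ∈ idx m)
    (h : code m y < code m x) : x.1 < y.1 ∨ (x.1 = y.1 ∧ x.2 < y.2) := by
  have hx' := lt_of_mem hm hx
  have hy' := lt_of_mem hm hy
  rcases digit_lt (N := 2 * m) (by omega) h with h | ⟨h1, h2⟩ <;> omega

/-! ### §5 Rows and columns of the pattern, and the two crossing-number facts -/

/-- **Row of the pattern at index `x`** (shape by shape; junk row `{0,1,2}` off the index set).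
[folklore] -/
def rowOf (m : ℕ) (hm : 3 ≤ m) (x : ℕ × ℕ) : OddSet (2 * m) :=
  if x.1 + 1 = 2 * m ∧ x.2 + 2 = 2 * m then mkRow (2 * m) 2 0 1 (by omega)
  else if h : x.1 % 2 = 1 ∧ x.2 % 2 = 1 ∧ 3 ≤ x.2 ∧ x.2 + 2 ≤ x.1 ∧ x.1 < 2 * m then
    mkRow (2 * m) 1 (x.2 + 1) x.1 (by omega)
  else if x.1 + 2 = 2 * m ∧ x.2 + 1 = 2 * m then rowY0 (2 * m) (by omega)
  else if h : x.1 + 2 = 2 * m ∧ x.2 % 2 = 1 ∧ 3 ≤ x.2 ∧ x.2 + 3 ≤ 2 * m then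
    mkRow (2 * m) (2 * m - 2) (x.2 - 1) x.2 (by omega)
  else if h : x.1 % 2 = 1 ∧ 1 ≤ x.1 ∧ x.1 + 5 ≤ 2 * m ∧ x.2 + 1 = 2 * m then
    mkRow (2 * m) 0 (x.1 + 3) (2 * m - 1) (by omega)
  else mkRow (2 * m) 2 0 1 (by omega)

/-- **Column of the pattern at index `x`** (shape by shape; junk column `X0` off the index set).
[folklore] -/
def colOf (m : ℕ) (hm : 3 ≤ m) (x : ℕ × ℕ) : TriCol (2 * m) :=
  if x.1 + 1 = 2 * m ∧ x.2 + 2 = 2 * m then ⟨2 * m - 1, 2 * m - 2, 2 * m - 2, 2 * m - 1, by omega⟩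
  else if h : x.1 % 2 = 1 ∧ x.2 % 2 = 1 ∧ 3 ≤ x.2 ∧ x.2 + 2 ≤ x.1 ∧ x.1 < 2 * m then
    ⟨x.1, x.1 - 1, x.2, x.2 - 1, by omega⟩
  else if x.1 + 2 = 2 * m ∧ x.2 + 1 = 2 * m then
    ⟨2 * m - 2, 2 * m - 1, 2 * m - 1, 2 * m - 2, by omega⟩
  else if h : x.1 + 2 = 2 * m ∧ x.2 % 2 = 1 ∧ 3 ≤ x.2 ∧ x.2 + 3 ≤ 2 * m then
    ⟨2 * m - 2, 2 * m - 1, x.2, x.2 - 1, by omega⟩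
  else if h : x.1 % 2 = 1 ∧ 1 ≤ x.1 ∧ x.1 + 5 ≤ 2 * m ∧ x.2 + 1 = 2 * m then
    ⟨x.1 + 2, x.1 + 1, 2 * m - 1, 2 * m - 2, by omega⟩
  else ⟨2 * m - 1, 2 * m - 2, 2 * m - 2, 2 * m - 1, by omega⟩

section Shapes

variable (hm : 3 ≤ m) {x : ℕ × ℕ}

/-- Row `X0`. [folklore] -/
private theorem mem_rowOf_X0 (hs : x.1 = 2 * m - 1 ∧ x.2 = 2 * m - 2) (v : Fin (2 * m)) :
    v ∈ (rowOf m hm x).1 ↔ ((v : ℕ) = 2 ∨ (0 ≤ (v : ℕ) ∧ (v : ℕ) ≤ 1)) := by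
  unfold rowOf
  rw [if_pos (by omega)]
  exact mem_mkRow _ v

/-- Column `X0`. [folklore] -/
private theorem colOf_X0 (hs : x.1 = 2 * m - 1 ∧ x.2 = 2 * m - 2) :
    (colOf m hm x).p + 1 = 2 * m ∧ (colOf m hm x).p' + 2 = 2 * m ∧ (colOf m hm x).q + 2 = 2 * m ∧
      (colOf m hm x).q' + 1 = 2 * m := by
  unfold colOf
  rw [if_pos (by omega)]
  dsimp only
  omega

/-- Row `C(p,q)`. [folklore] -/
private theorem mem_rowOf_C (hs : x.1 % 2 = 1 ∧ x.2 % 2 = 1 ∧ 3 ≤ x.2 ∧ x.2 + 2 ≤ x.1 ∧ x.1 < 2 * m)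
    (v : Fin (2 * m)) :
    v ∈ (rowOf m hm x).1 ↔ ((v : ℕ) = 1 ∨ (x.2 + 1 ≤ (v : ℕ) ∧ (v : ℕ) ≤ x.1)) := by
  unfold rowOf
  rw [if_neg (by omega), dif_pos hs]
  exact mem_mkRow _ v

/-- Column `C(p,q)`. [folklore] -/
private theorem colOf_C (hs : x.1 % 2 = 1 ∧ x.2 % 2 = 1 ∧ 3 ≤ x.2 ∧ x.2 + 2 ≤ x.1 ∧ x.1 < 2 * m) :
    (colOf m hm x).p = x.1 ∧ (colOf m hm x).p' + 1 = x.1 ∧ (colOf m hm x).q = x.2 ∧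
      (colOf m hm x).q' + 1 = x.2 := by
  unfold colOf
  rw [if_neg (by omega), dif_pos hs]
  dsimp only
  omega

/-- Row `Y0`. [folklore] -/
private theorem mem_rowOf_Y0 (hs : x.1 = 2 * m - 2 ∧ x.2 = 2 * m - 1) (v : Fin (2 * m)) :
    v ∈ (rowOf m hm x).1 ↔ ((v : ℕ) = 0 ∨ (v : ℕ) = 2 ∨ (v : ℕ) = 2 * m - 1) := by
  unfold rowOf
  rw [if_neg (by omega), dif_neg (by omega), if_pos (by omega)]
  exact mem_rowY0 _ v

/-- Column `Y0`. [folklore] -/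
private theorem colOf_Y0 (hs : x.1 = 2 * m - 2 ∧ x.2 = 2 * m - 1) :
    (colOf m hm x).p + 2 = 2 * m ∧ (colOf m hm x).p' + 1 = 2 * m ∧ (colOf m hm x).q + 1 = 2 * m ∧
      (colOf m hm x).q' + 2 = 2 * m := by
  unfold colOf
  rw [if_neg (by omega), dif_neg (by omega), if_pos (by omega)]
  dsimp only
  omega

/-- Row `B(q)`. [folklore] -/
private theorem mem_rowOf_B (hs : x.1 = 2 * m - 2 ∧ x.2 % 2 = 1 ∧ 3 ≤ x.2 ∧ x.2 + 3 ≤ 2 * m)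
    (v : Fin (2 * m)) :
    v ∈ (rowOf m hm x).1 ↔ ((v : ℕ) = 2 * m - 2 ∨ (x.2 - 1 ≤ (v : ℕ) ∧ (v : ℕ) ≤ x.2)) := by
  unfold rowOf
  rw [if_neg (by omega), dif_neg (by omega), if_neg (by omega), dif_pos (by omega)]
  exact mem_mkRow _ v

/-- Column `B(q)`. [folklore] -/
private theorem colOf_B (hs : x.1 = 2 * m - 2 ∧ x.2 % 2 = 1 ∧ 3 ≤ x.2 ∧ x.2 + 3 ≤ 2 * m) :
    (colOf m hm x).p + 2 = 2 * m ∧ (colOf m hm x).p' + 1 = 2 * m ∧ (colOf m hm x).q = x.2 ∧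
      (colOf m hm x).q' + 1 = x.2 := by
  unfold colOf
  rw [if_neg (by omega), dif_neg (by omega), if_neg (by omega), dif_pos (by omega)]
  dsimp only
  omega

/-- Row `C1`. [folklore] -/
private theorem mem_rowOf_C1 (hs : x.1 % 2 = 1 ∧ 1 ≤ x.1 ∧ x.1 + 5 ≤ 2 * m ∧ x.2 = 2 * m - 1)
    (v : Fin (2 * m)) :
    v ∈ (rowOf m hm x).1 ↔ ((v : ℕ) = 0 ∨ (x.1 + 3 ≤ (v : ℕ) ∧ (v : ℕ) ≤ 2 * m - 1)) := by
  unfold rowOf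
  rw [if_neg (by omega), dif_neg (by omega), if_neg (by omega), dif_neg (by omega),
    dif_pos (by omega)]
  exact mem_mkRow _ v

/-- Column `C1`. [folklore] -/
private theorem colOf_C1 (hs : x.1 % 2 = 1 ∧ 1 ≤ x.1 ∧ x.1 + 5 ≤ 2 * m ∧ x.2 = 2 * m - 1) :
    (colOf m hm x).p = x.1 + 2 ∧ (colOf m hm x).p' + 1 = x.1 + 2 ∧ (colOf m hm x).q = 2 * m - 1 ∧
      (colOf m hm x).q' + 1 = 2 * m - 1 := by
  unfold colOf
  rw [if_neg (by omega), dif_neg (by omega), if_neg (by omega), dif_neg (by omega),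
    dif_pos (by omega)]
  dsimp only
  omega

end Shapes

/-- **Diagonal of the pattern**: `|δ(U_x) ∩ T_x| ≥ 2` (in fact `= 3`) for every index `x`, so the
slack `|δ(U_x) ∩ T_x| − 1` is non-zero there. [cite: Rothvoss2017, §2 (PDF p. 5)] -/
theorem two_le_cc_rowOf_colOf (hm : 3 ≤ m) {x : ℕ × ℕ} (hx : x ∈ idx m) :
    2 ≤ cc (rowOf m hm x) (colOf m hm x).toPMatch := by
  rcases shape_of_mem hx with hs | hs | hs | hs | hs
  · exact two_le_cc_X0 _ _ (colOf_X0 hm hs) (mem_rowOf_X0 hm hs) (by omega)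
  · exact two_le_cc_C _ _ (colOf_C hm hs) (mem_rowOf_C hm hs) (by omega)
  · exact two_le_cc_Y0 _ _ (colOf_Y0 hm hs) (mem_rowOf_Y0 hm hs) (by omega)
  · exact two_le_cc_B _ _ (colOf_B hm hs) (mem_rowOf_B hm hs) (by omega)
  · exact two_le_cc_C1 _ _ (colOf_C1 hm hs) (mem_rowOf_C1 hm hs) (by omega)

/-- **Off the diagonal**: if the index `y` is lexicographically larger than `x` (smaller code, i.e.
EARLIER in the pattern) then the column `T_y` is tight on the row `U_x`: `|δ(U_x) ∩ T_y| = 1`.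
Sixteen shape combinations, the others are excluded by the order. [cite: Rothvoss2017, §2 (PDF p. 5)] -/
theorem cc_rowOf_colOf_eq_one (hm : 3 ≤ m) {x y : ℕ × ℕ} (hx : x ∈ idx m) (hy : y ∈ idx m)
    (hlt : code m y < code m x) : cc (rowOf m hm x) (colOf m hm y).toPMatch = 1 := by
  have hlex := lex_of_code_lt hm hx hy hlt
  rcases shape_of_mem hx with hsx | hsx | hsx | hsx | hsx <;>
    rcases shape_of_mem hy with hsy | hsy | hsy | hsy | hsy
  -- row `X0`: nothing is earlier
  · omega
  · omega
  · omega
  · omega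
  · omega
  -- row `C(p,q)`
  · exact cc_rowC_colX0 _ _ (colOf_X0 hm hsy) (mem_rowOf_C hm hsx) (by omega)
  · rcases hlex with h | ⟨h1, h2⟩
    · exact cc_rowC_colC_gt _ _ (colOf_C hm hsy) (mem_rowOf_C hm hsx) (by omega)
    · exact cc_rowC_colC_eq _ _ (Q := y.2) (by have := colOf_C hm hsy; omega)
        (mem_rowOf_C hm hsx) (by omega)
  · exact cc_rowC_colY0 _ _ (colOf_Y0 hm hsy) (mem_rowOf_C hm hsx) (by omega)
  · exact cc_rowC_colB _ _ (colOf_B hm hsy) (mem_rowOf_C hm hsx) (by omega)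
  · exact cc_rowC_colC_gt _ _ (colOf_C1 hm hsy) (mem_rowOf_C hm hsx) (by omega)
  -- row `Y0`
  · exact cc_rowY0_colX0 _ _ (colOf_X0 hm hsy) (mem_rowOf_Y0 hm hsx) (by omega)
  · exact cc_rowY0_colC _ _ (Q := y.2) (by have := colOf_C hm hsy; omega) (mem_rowOf_Y0 hm hsx)
      (by omega)
  · omega
  · omega
  · omega
  -- row `B(q)`
  · exact cc_rowB_colX0 _ _ (colOf_X0 hm hsy) (mem_rowOf_B hm hsx) (by omega)
  · exact cc_rowB_colC _ _ (Q := y.2) (by have := colOf_C hm hsy; omega) (mem_rowOf_B hm hsx)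
      (by omega)
  · exact cc_rowB_colY0 _ _ (colOf_Y0 hm hsy) (mem_rowOf_B hm hsx) (by omega)
  · exact cc_rowB_colB _ _ (colOf_B hm hsy) (mem_rowOf_B hm hsx) (by omega)
  · omega
  -- row `C1`
  · exact cc_rowC1_colX0 _ _ (colOf_X0 hm hsy) (mem_rowOf_C1 hm hsx) (by omega)
  · rcases Nat.lt_or_ge (x.1 + 2) y.1 with h | h
    · exact cc_rowC1_colC_gt _ _ (colOf_C hm hsy) (mem_rowOf_C1 hm hsx) (by omega)
    · exact cc_rowC1_colC_eq _ _ (Q := y.2) (by have := colOf_C hm hsy; omega)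
        (mem_rowOf_C1 hm hsx) (by omega)
  · exact cc_rowC1_colY0 _ _ (colOf_Y0 hm hsy) (mem_rowOf_C1 hm hsx) (by omega)
  · exact cc_rowC1_colB _ _ (colOf_B hm hsy) (mem_rowOf_C1 hm hsx) (by omega)
  · exact cc_rowC1_colC_gt _ _ (colOf_C1 hm hsy) (mem_rowOf_C1 hm hsx) (by omega)

/-! ### §6 The support-based certificate of size `C(m+1, 2) − 1` and the psd-rank floor -/

/-- **An explicit psd fooling set of size `C(m+1,2) − 1` in Edmonds' odd-cut slack matrix of
`K_{2m}`** (`m ≥ 3`). Ordered by decreasing index, the pairs `(U_x, T_x)` form a triangular pattern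
of the slack matrix `S_{UM} = |δ(U) ∩ M| − 1`: `S(U_x, T_x) ≠ 0` and `S(U_x, T_y) = 0` whenever `y`
comes earlier. Hence EVERY nonnegative matrix with the support of `S` has psd rank
`≥ C(m+1,2) − 1`: `IsSupportBasedPsdBound (2m) (C(m+1,2) − 1)` — sharpening the tree's
`isSupportBasedPsdBound_choose_two` (`C(m−1,2)`) by `2m − 2`; for `m ≤ 6` this is the EXACT maximum
size of a triangular pattern (exhaustive search, engineering memo of the cell; not formalised).
(`m = 2` is genuinely excluded: the odd-cut slack matrix of `K_4` vanishes identically.)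
[cite: FawziEtAl2015, Thm. 2.10 + Ex. 2.11 (p07); §5.2 (p15)] -/
theorem isSupportBasedPsdBound_choose_succ (hm : 3 ≤ m) :
    IsSupportBasedPsdBound (2 * m) ((m + 1).choose 2 - 1) := by
  intro N hN hsupp r hr hfac
  have key : (idx m).card ≤ r := by
    refine card_le_of_triangular_code hfac (idx m) (code m) (code_injOn hm) (rowOf m hm)
      (fun x => (colOf m hm x).toPMatch) ?_ ?_
    · intro x hx h0
      have h1 : cc (rowOf m hm x) (colOf m hm x).toPMatch = 1 :=
        (pmOddCutSlack_eq_zero_iff _ _).1 ((hsupp _ _).1 h0)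
      have h2 := two_le_cc_rowOf_colOf hm hx
      omega
    · intro x hx y hy hcode
      rw [hsupp, pmOddCutSlack_eq_zero_iff]
      exact cc_rowOf_colOf_eq_one hm hx hy hcode
  rw [card_idx hm] at key
  omega

/-- **Unconditional psd-rank floor for Edmonds' odd-cut slack matrix, sharp form**: every psd
factorisation of `S_{UM} = |δ(U) ∩ M| − 1` on (odd sets) × (perfect matchings of `K_{2m}`),
`m ≥ 3`, has size `≥ C(m+1, 2) − 1` (`= 5, 9, 14, 20, 27, 35, 44, …` for `m = 3, 4, …`; still
`≈ n²/8`). [cite: FawziEtAl2015, Thm. 2.10 + Ex. 2.11 (p07); §5.2 (p15)] -/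
theorem choose_succ_le_of_hasPsdFactorization (hm : 3 ≤ m) {r : ℕ}
    (h : HasPsdFactorization (pmOddCutSlack (2 * m)) r) : (m + 1).choose 2 - 1 ≤ r := by
  by_contra hlt
  exact isSupportBasedPsdBound_choose_succ hm (pmOddCutSlack (2 * m))
    (fun U M => pmOddCutSlack_nonneg U M) (fun U M => Iff.rfl) r (lt_of_not_ge hlt) h

/-- The same floor for even `n ≥ 6`, in the `n`-indexed form: the psd rank of the odd-cut slack
matrix of `K_n` is at least `C(n/2 + 1, 2) − 1`. [cite: FawziEtAl2015, Thm. 2.10 + Ex. 2.11 (p07); §5.2 (p15)] -/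
theorem choose_succ_le_of_hasPsdFactorization_even {n r : ℕ} (hn : Even n) (h6 : 6 ≤ n)
    (h : HasPsdFactorization (pmOddCutSlack n) r) : (n / 2 + 1).choose 2 - 1 ≤ r := by
  obtain ⟨m, rfl⟩ := hn
  rw [← two_mul] at h
  have := choose_succ_le_of_hasPsdFactorization (by omega) h
  rwa [show (m + m) / 2 = m by omega]

/-- The `n`-indexed form of the certificate: for even `n ≥ 6`,
`IsSupportBasedPsdBound n (C(n/2 + 1, 2) − 1)`. [cite: FawziEtAl2015, §5.2 (p15); Thm. 2.10 + Ex. 2.11 (p07)] -/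
theorem isSupportBasedPsdBound_even_choose_succ {n : ℕ} (hn : Even n) (h6 : 6 ≤ n) :
    IsSupportBasedPsdBound n ((n / 2 + 1).choose 2 - 1) := by
  obtain ⟨m, rfl⟩ := hn
  rw [← two_mul, show 2 * m / 2 = m by omega]
  exact isSupportBasedPsdBound_choose_succ (by omega)

/-- **The support-based window, sharp form** (`m ≥ 3`): the support-based technique class for
Edmonds' odd-cut slack matrix of `K_{2m}` certifies `C(m+1, 2) − 1` and never more than the dimension
bound `C(2m, 2) + 1 − 2m` (`supportBasedPsdBound_le_dim` of the companion file); the two differ by a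
factor `< 4`. [cite: FawziEtAl2015, §5.2 (p15); Thm. 2.9 (v) (p06–p07); Thm. 2.10 (p07)] -/
theorem supportBased_window_choose_succ (hm : 3 ≤ m) :
    IsSupportBasedPsdBound (2 * m) ((m + 1).choose 2 - 1) ∧
      ∀ R, IsSupportBasedPsdBound (2 * m) R → R ≤ (2 * m).choose 2 + 1 - 2 * m :=
  ⟨isSupportBasedPsdBound_choose_succ hm, fun _ hR => supportBasedPsdBound_le_dim (by omega) hR⟩

/-- Instance `n = 18` (beyond the kernel-checked patterns `n ≤ 16` of the companion small-`n` file):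
`IsSupportBasedPsdBound 18 44`. [cite: FawziEtAl2015, Thm. 2.10 + Ex. 2.11 (p07); §5.2 (p15)] -/
theorem isSupportBasedPsdBound_eighteen : IsSupportBasedPsdBound 18 44 := by
  have h := isSupportBasedPsdBound_choose_succ (m := 9) (by norm_num)
  norm_num [Nat.choose_two_right] at h
  exact h

end PsdFoolingSet

end Literature.Barriers.PneNP
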